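import Literature.AlgebraicGeometry.Modules.CechLocalizedSectionsAffine
import Literature.AlgebraicGeometry.Modules.AffineLocalizing
import HarnessLib

/-!
# The localized-sections Čech sheaves `P̌ⁿ(𝓤, F)` are affine-localizing (quasi-coherent in the sense of
# Hartshorne II Lemma 5.3 / EGA I 1.4.1 d1), d2)) for ANY `𝒪_X`-module `F` and a finite family `𝓤`
# (Görtz–Wedhorn II, proof of Lemma 22.36 and the remark after it: the coherator; Hartshorne II Prop. 5.1–5.2, Cor. 5.5)

Sequel of `Modules/CechLocalizedSectionsAffine`. For a scheme `X`, a FINITE family of opens `𝓤 = (U_i)_{i ∈ ι}` and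
an `𝒪_X`-module `F`, the sheaf `P̌ⁿ(𝓤, F) = PCech.obj U n F` (`Modules/CechLocalizedSections`: the sheafification of
`V ↦ Π_α Γ(X, V ⊓ U_α) ⊗_{Γ(X, U_α)} Γ(F, U_α)`) is AFFINE-LOCALIZING (`Modules/AffineLocalizing`: numerators and
torsion for the restriction `Γ(V, –) → Γ(D(r), –)`, `V` affine, `r ∈ Γ(X, V)`), as soon as every affine open `V`
meets every face `U_α` in an affine open (e.g. `X` separated and the `U_i` affine):

* §1 one piece: by `isLocalizedModule_restrictPiece` (lemma (L)'s localization statement,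
  `Γ(X, D(r) ⊓ U_α) ⊗ Γ(F, U_α) = (Γ(X, V ⊓ U_α) ⊗ Γ(F, U_α))_{r|}`) the restriction of pieces `Piece V α → Piece D(r) α`
  has numerators (`exists_restrictPiece_eq_pow_smul`) and torsion (`exists_pow_smul_eq_zero_of_restrictPiece_eq_zero`);
* §2 the finite product over the simplices `α : Fin (n + 1) → ι` (`ι` finite): uniform exponents
  (`exists_restrict_eq_pow_smul`, `exists_pow_smul_eq_zero_of_restrict_eq_zero`);
* §3 the sheaf: sections of `P̌ⁿ(𝓤, F)` over the affine `V` and over `D(r)` ARE these products by lemma (L)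
  `toObj_app_bijective` (both opens are affine and meet the faces in affines), the unit `η` being linear and compatible
  with restriction (`toObj_app_smul`, `map_toObj_app`); hence **`PCech.isAffineLocalizing_obj`**.

This is the «`P̌` has quasi-coherent terms» input of Stage I of the `D⁺_qc` comparison (Görtz–Wedhorn II Lemma 22.36 /
Hartshorne RD II 7.19 / Thomason–Trobaugh B.16): `Tot P̌(𝓤, I•)` is a complex of quasi-coherent modules. Everything is
PROVED; 0 named facts, no definitions, no instances. Typed for the cell `pub-hodge-ring2` — a research route conditional
on HC_CM, not a corollary; nothing in this file refers to it.

## References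

* R. Hartshorne, *Algebraic Geometry*, GTM 52 (1977), II Prop. 5.1–5.2 (pp. 110–111), Lemma 5.3 (p. 112), Cor. 5.5
  (p. 113). [Hartshorne1977]
* U. Görtz, T. Wedhorn, *Algebraic Geometry II: Cohomology of Schemes*, Springer Spektrum (2023), Lemma 22.36 and the
  remark following it (pp. 349–350). [GortzWedhorn2023]
* The Stacks Project, Tags 01I7, 08D6 (coherator). [StacksProject]
-/

noncomputable section

-- `TopCat.Presheaf`/`Scheme.Modules` are not reducible (as in Mathlib's `AlgebraicGeometry/Modules/Sheaf.lean`).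
set_option backward.isDefEq.respectTransparency false

universe u

open CategoryTheory CategoryTheory.Limits Opposite TopologicalSpace AlgebraicGeometry TensorProduct

namespace Literature.AlgebraicGeometry.Modules

namespace PCech

variable {X : Scheme.{u}} {ι : Type u} (U : ι → X.Opens) (n : ℕ) (F : X.Modules)

/-! ## §1 One piece: numerators and torsion for `Piece V α → Piece D(r) α` -/

section Piece

variable {V : X.Opens} (α : Fin (n + 1) → ι)

/-- For `r ∈ Γ(X, V)`: `D(r) ⊓ U_α = D(r|_{V ⊓ U_α})` with the restriction written as `Cech.resO`.
[cite: Hartshorne1977, II Prop. 5.2 (p. 110)] -/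
theorem basicOpen_inf_face_resO (r : Γ(X, V)) :
    X.basicOpen r ⊓ face U α = X.basicOpen (Cech.resO (X := X) (inf_le_left : V ⊓ face U α ≤ V) r) :=
  basicOpen_inf_face U n V α r

/-- **Numerators for one piece**: every element of `Γ(X, D(r) ⊓ U_α) ⊗_{Γ(X, U_α)} Γ(F, U_α)` becomes, after
multiplication by a power of `r`, the restriction of an element of `Γ(X, V ⊓ U_α) ⊗_{Γ(X, U_α)} Γ(F, U_α)` — the
restriction of pieces is a localization at `r|_{V ⊓ U_α}` (`isLocalizedModule_restrictPiece`) when `V ⊓ U_α` is affine.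
[cite: Hartshorne1977, II Prop. 5.1–5.2 (p. 110) and Lemma 5.3 (p. 112)] -/
theorem exists_restrictPiece_eq_pow_smul (hVα : IsAffineOpen (V ⊓ face U α)) (r : Γ(X, V))
    (s : Piece U n F (X.basicOpen r) α) :
    ∃ (k : ℕ) (x : Piece U n F V α), restrictPiece U n F (X.basicOpen_le r) α x =
      (letI := pieceModule U n F (X.basicOpen r) α; Cech.resO (X := X) (X.basicOpen_le r) r ^ k • s) := by
  letI := pieceModuleOfLE U n F α (X.basicOpen_le r)
  have hloc := isLocalizedModule_restrictPiece U n F α (X.basicOpen_le r) hVα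
    (Cech.resO (X := X) (inf_le_left : V ⊓ face U α ≤ V) r) (basicOpen_inf_face_resO U n α r)
  obtain ⟨⟨x, ⟨_, k, rfl⟩⟩, hx⟩ :=
    IsLocalizedModule.surj (Submonoid.powers (Cech.resO (X := X) (inf_le_left : V ⊓ face U α ≤ V) r))
      (restrictPieceₗ U n F α (X.basicOpen_le r)) s
  refine ⟨k, x, ?_⟩
  simp only [Submonoid.smul_def, restrictPieceₗ_apply] at hx
  rw [← hx]
  change Cech.resO (X := X) (inf_le_inf_right (face U α) (X.basicOpen_le r))
      (Cech.resO (X := X) (inf_le_left : V ⊓ face U α ≤ V) r ^ k) • s =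
    Cech.resO (X := X) (inf_le_left : X.basicOpen r ⊓ face U α ≤ X.basicOpen r)
      (Cech.resO (X := X) (X.basicOpen_le r) r ^ k) • s
  rw [map_pow, map_pow, Cech.resO_resO, Cech.resO_resO]

/-- **Torsion for one piece**: an element of `Γ(X, V ⊓ U_α) ⊗_{Γ(X, U_α)} Γ(F, U_α)` restricting to zero over `D(r)`
is killed by a power of `r` (`V ⊓ U_α` affine). [cite: Hartshorne1977, II Prop. 5.1–5.2 (p. 110) and Lemma 5.3 (p. 112)] -/
theorem exists_pow_smul_eq_zero_of_restrictPiece_eq_zero (hVα : IsAffineOpen (V ⊓ face U α)) (r : Γ(X, V))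
    (x : Piece U n F V α) (hx : restrictPiece U n F (X.basicOpen_le r) α x = 0) :
    ∃ k : ℕ, (letI := pieceModule U n F V α; r ^ k • x) = 0 := by
  letI := pieceModuleOfLE U n F α (X.basicOpen_le r)
  have hloc := isLocalizedModule_restrictPiece U n F α (X.basicOpen_le r) hVα
    (Cech.resO (X := X) (inf_le_left : V ⊓ face U α ≤ V) r) (basicOpen_inf_face_resO U n α r)
  have h0 : restrictPieceₗ U n F α (X.basicOpen_le r) x = restrictPieceₗ U n F α (X.basicOpen_le r) 0 := by
    rw [map_zero, restrictPieceₗ_apply, hx]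
  obtain ⟨⟨_, k, rfl⟩, hk⟩ :=
    IsLocalizedModule.exists_of_eq (S := Submonoid.powers (Cech.resO (X := X) (inf_le_left : V ⊓ face U α ≤ V) r))
      (f := restrictPieceₗ U n F α (X.basicOpen_le r)) h0
  refine ⟨k, ?_⟩
  simp only [Submonoid.smul_def, smul_zero] at hk
  change Cech.resO (X := X) (inf_le_left : V ⊓ face U α ≤ V) (r ^ k) • x = 0
  rw [map_pow]
  exact hk

end Piece

/-! ## §2 The finite product over the simplices: uniform exponents -/

section Sections

variable [Finite ι] {V : X.Opens}

/-- **Numerators for `Π_α Piece`** (finitely many `α`): a uniform power of `r`. [cite: Hartshorne1977, II Lemma 5.3 (p. 112) and Cor. 5.5 (p. 113)] -/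
theorem exists_restrict_eq_pow_smul (hVα : ∀ α : Fin (n + 1) → ι, IsAffineOpen (V ⊓ face U α)) (r : Γ(X, V))
    (s : Sections U n F (X.basicOpen r)) :
    ∃ (k : ℕ) (x : Sections U n F V),
      restrict U n F (X.basicOpen_le r) x = Cech.resO (X := X) (X.basicOpen_le r) r ^ k • s := by
  classical
  choose k x hx using fun α => exists_restrictPiece_eq_pow_smul U n F α (hVα α) r (s α)
  haveI : Fintype (Fin (n + 1) → ι) := Fintype.ofFinite _
  let K : ℕ := Finset.univ.sup k
  have hK : ∀ α, k α ≤ K := fun α => Finset.le_sup (Finset.mem_univ α)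
  refine ⟨K, fun α => (letI := pieceModule U n F V α; r ^ (K - k α) • x α), funext fun α => ?_⟩
  letI := pieceModule U n F V α
  letI := pieceModule U n F (X.basicOpen r) α
  rw [restrict_apply, smul_apply, restrictPiece_smul, hx, smul_smul, map_pow, ← pow_add, Nat.sub_add_cancel (hK α)]

/-- **Torsion for `Π_α Piece`** (finitely many `α`): a uniform power of `r`. [cite: Hartshorne1977, II Lemma 5.3 (p. 112) and Cor. 5.5 (p. 113)] -/
theorem exists_pow_smul_eq_zero_of_restrict_eq_zero (hVα : ∀ α : Fin (n + 1) → ι, IsAffineOpen (V ⊓ face U α))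
    (r : Γ(X, V)) (x : Sections U n F V) (hx : restrict U n F (X.basicOpen_le r) x = 0) :
    ∃ k : ℕ, r ^ k • x = 0 := by
  classical
  choose k hk using fun α => exists_pow_smul_eq_zero_of_restrictPiece_eq_zero U n F α (hVα α) r (x α)
    (by have h := congrFun hx α; rwa [restrict_apply] at h)
  haveI : Fintype (Fin (n + 1) → ι) := Fintype.ofFinite _
  let K : ℕ := Finset.univ.sup k
  have hK : ∀ α, k α ≤ K := fun α => Finset.le_sup (Finset.mem_univ α)
  refine ⟨K, funext fun α => ?_⟩
  letI := pieceModule U n F V α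
  rw [smul_apply, zero_apply, ← Nat.sub_add_cancel (hK α), pow_add, mul_smul, hk, smul_zero]

end Sections

/-! ## §3 The sheaf `P̌ⁿ(𝓤, F)` is affine-localizing -/

section Sheaf

/-- The unit `η_V : Π_α Piece V α → Γ(V, P̌ⁿ(𝓤, F))` is `Γ(X, V)`-linear. [cite: StacksProject, Tag 08D6] -/
theorem toObj_app_smul (V : X.Opens) (r : Γ(X, V)) (s : Sections U n F V) :
    (toObj U n F).app (op V) (r • s) = r • (toObj U n F).app (op V) s :=
  ((toObj U n F).app (op V)).hom.map_smul r s

/-- The unit commutes with restriction: `(η_V s)|_W = η_W (s|_W)`. [cite: StacksProject, Tag 08D6] -/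
theorem map_toObj_app {V W : X.Opens} (h : W ≤ V) (s : Sections U n F V) :
    (obj U n F).presheaf.map (homOfLE h).op ((toObj U n F).app (op V) s) =
      (toObj U n F).app (op W) (restrict U n F h s) := by
  have e := app_resP (X := X) (sheafifyUnit (X := X) (presheafMod U n F)) h s
  rw [resP_presheafMod] at e
  exact e.symm

variable [Finite ι]

/-- **The localized-sections Čech sheaf `P̌ⁿ(𝓤, F)` is affine-localizing** for every `𝒪_X`-module `F` and every
finite family `𝓤` such that every affine open meets every face `U_α` in an affine open (e.g. `X` separated, `U_i`
affine): on an affine `V` and on `D(r) ⊆ V` its sections are `Π_α Γ(X, – ⊓ U_α) ⊗_{Γ(X, U_α)} Γ(F, U_α)` (lemma (L),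
`toObj_app_bijective`), and the restriction between them is, factor by factor, a localization at `r|` — the
coherator `(Γ(F, U_α))~` is quasi-coherent (Görtz–Wedhorn II after Lemma 22.36; Hartshorne II Cor. 5.5).
[cite: GortzWedhorn2023, Lemma 22.36 (pp. 349–350)] [cite: Hartshorne1977, II Lemma 5.3 (p. 112) and Cor. 5.5 (p. 113)] -/
theorem isAffineLocalizing_obj
    (hgood : ∀ ⦃V : X.Opens⦄, IsAffineOpen V → ∀ α : Fin (n + 1) → ι, IsAffineOpen (V ⊓ face U α)) :
    IsAffineLocalizing (PCech.obj U n F) := by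
  constructor
  · intro V hV r W hW s
    subst hW
    have hD : IsAffineOpen (X.basicOpen r) := hV.basicOpen r
    obtain ⟨t, rfl⟩ := (toObj_app_bijective U n F hD (hgood hD)).2 s
    obtain ⟨k, x, hx⟩ := exists_restrict_eq_pow_smul U n F (hgood hV) r t
    refine ⟨k, (toObj U n F).app (op V) x, ?_⟩
    rw [map_toObj_app, hx, toObj_app_smul]
  · intro V hV r s W hWV hrW hs
    obtain ⟨x, rfl⟩ := (toObj_app_bijective U n F hV (hgood hV)).2 s
    have hD : IsAffineOpen (X.basicOpen r) := hV.basicOpen r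
    -- restrict further to `D(r)`
    have h0 : (obj U n F).presheaf.map (homOfLE (X.basicOpen_le r)).op ((toObj U n F).app (op V) x) = 0 := by
      have e : (homOfLE (X.basicOpen_le r)).op = (homOfLE hWV).op ≫ (homOfLE hrW).op := rfl
      rw [e, Functor.map_comp, CategoryTheory.comp_apply, hs, map_zero]
    rw [map_toObj_app] at h0
    have h1 : restrict U n F (X.basicOpen_le r) x = 0 :=
      (toObj_app_bijective U n F hD (hgood hD)).1 (by rw [h0, map_zero])
    obtain ⟨k, hk⟩ := exists_pow_smul_eq_zero_of_restrict_eq_zero U n F (hgood hV) r x h1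
    exact ⟨k, by rw [← toObj_app_smul, hk, map_zero]⟩

end Sheaf

end PCech

end Literature.AlgebraicGeometry.Modules

end
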